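import Summits.BirchSwinnertonDyer.BirchSwinnertonDyer.Theorems.KimAtThreeDeepLowerExpStarOmega
import Literature.NumberTheory.GaloisRepresentations.PadicAlgebraOfLocalField
import HarnessLib

/-!
# `exp*_ω` at a place `v ∣ p` of `ℚ`: the scalar dual exponential on the tree's
# `H¹(ℚ_v, T_pW) = (tateLocalRep W p (inr v)).cohomology 1`, valued in `ℚ_v` and in `ℚ_p`
# (route `KimAtThreeKolyvagin`, rung W2; cell `bsd-addord`, seat w2-c2 gen 8; sequel of
# `KimAtThreeDeepLowerExpStarOmega`)

HONEST FRAMING. Definitions with bodies and proved API (no named fact, no `sorry`, no GLOBAL instance — the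
structures on `ℚ_v` are plain definitions switched on with `attribute [local instance]` INSIDE this file only —,
no notation); nothing is closed or booked; BSD is not proved by any of this.

This is §3 of the prequel: `K = ℚ`, a finite place `v` with `p ∈ v` (keyed on the instance binder
`[Fact (((p : ℕ) : 𝓞 ℚ) ∈ v.asIdeal)]`; a consumer holding `hv₃ : ((3 : ℕ) : 𝓞 ℚ) ∈ v₃.asIdeal` writes
`haveI := Fact.mk hv₃`). It NAMES, as plain definitions (local instances here; a consumer installs them with `letI` or
`attribute [local instance]`), exactly the structures on `ℚ_v = Place.Completion (inr v)`
(definitionally `v.adicCompletion ℚ`) that the tree's `PAdicHodge.bdRPeriodRingData` asks for —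
`valuativeRelPlace`, `topologicalSpacePlace`, `isNonarchimedeanLocalField_place`, `charZero_place` (the
tree's accepted instances / theorems re-keyed on the `Place.Completion` spelling used by `tateLocalRep`),
`padicAlgebraPlace := LocalField.adicCompletionPadicAlgebra v p _` (the CANONICAL `ℚ_p`-algebra structure:
the unique continuous `ℚ_p → ℚ_v`), `valuation_place_lt_one` (`|p|_v < 1`), `fact_not_isUnit_place`,
`isAdicComplete_place` —, and names the restriction `galRestrictPlace v : Γ_{ℚ_v} → Γ_ℚ` with the tree's
`ℚ`-algebra structure `Place.instAlgebraCompletion`, BEFORE the local instances are switched on (with `CharZero ℚ_v` in scope, class inference would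
put `DivisionRing.toRatAlgebra` on `ℚ_v` and break the definitional equality), so that
`localTateRep W p (galRestrictPlace v) = tateLocalRep W p (Sum.inr v)` holds by `rfl`
(`localTateRep_galRestrictPlace`). Then:

* `LocalNeronLineAt W p v` — a generator of `D⁰_dR(V_pW|_{Γ_{ℚ_v}})` for `bdRPeriodRingData` at `ℚ_v`;
* **`expStarOmegaAt d : (tateLocalRep W p (Sum.inr v)).cohomology 1 → ℚ_v`**, `expStarOmegaAt_oneCocycleClass`,
  additivity under the two Prop-1.2.3 binders (`expStarOmegaAt_add`), `expStarOmegaAtHom`;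
* **`expStarOmegaPadicAt d hinj hex ι : (tateLocalRep W p (Sum.inr v)).cohomology 1 →+ ℚ_[p]`** for a ring
  homomorphism `ι : ℚ_v →+* ℚ_[p]` (for `K = ℚ` the unique one — e.g. Mathlib's `adicCompletion.padicEquiv v`
  — an isomorphism) — EXACTLY the type of the abstract `φ = exp*_ω` of kim3's hK (crux 19560) and of w2-c3's
  (C1ₑₓ) (cruxes 19075 / 19076, `KimAtThreeDeepLeafOfDefinedKatoUniform`); `expStarOmegaPadicAt_eq_zero_iff`
  (the kernel clause `hker` does not see `ι`, nor the generator: `expStarOmegaAt_smul_eq_zero_iff`).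

Displayed, NOT discharged here (see the prequel's docstring): the Prop-1.2.3 binders `hinj` / `hex`, the
existence of the line datum (`Nonempty (LocalNeronLineAt W p v)`, supplied from
`PAdicHodge.nonempty_neronDeRhamDatum` in the sequel `KimAtThreeDeepLowerExpStarOmegaLine`),
`exp*`-functoriality in the field.

References: K. Kato, LNM 1553 (1993), Ch. II §1.2.4, Prop. 1.2.3, Ex. 1.3.5 [Kato1993LNM1553]; S. Bloch,
K. Kato (1990) §3 [BlochKato1990]; J.-P. Serre, *Local Fields*, Ch. II §5 (the `ℚ_p`-structure of a `p`-adic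
field) [SerreLocalFields1979].
-/

set_option autoImplicit false
-- the Theorems namespace of a single-conjunct summit repeats the summit name by design (D-0017)
set_option linter.dupNamespace false

noncomputable section

open scoped TensorProduct NumberField
open Field ValuativeRel Function IsDedekindDomain NumberField
open Literature.NumberTheory.GaloisRepresentations
open Literature.NumberTheory.GaloisRepresentations.PeriodRingData
open Literature.NumberTheory.PAdicHodge
open Literature.NumberTheory.EllipticCurves
open Summit.BirchSwinnertonDyer.BirchSwinnertonDyer.Theorems.KimAtThreeDeepLowerExpStarOmega

namespace Summit.BirchSwinnertonDyer.BirchSwinnertonDyer.Theorems.KimAtThreeDeepLowerExpStarOmegaPlace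

variable (W : WeierstrassCurve ℚ) [W.IsElliptic] (p : ℕ) [Fact p.Prime]
  (v : HeightOneSpectrum (𝓞 ℚ)) [hv : Fact (((p : ℕ) : 𝓞 ℚ) ∈ v.asIdeal)]

omit [Fact p.Prime] hv in
/-- **The restriction `Γ_{ℚ_v} → Γ_ℚ`** of the tree (`absGaloisRestrict ℚ (Place.Completion (inr v))`, the
`r` of `tateLocalRep W p (Sum.inr v)`), named BEFORE the local-field instances of `ℚ_v` are registered
below, so that its `ℚ`-algebra structure on `ℚ_v` is the tree's `Place.instAlgebraCompletion` (and not the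
one class inference would derive from `CharZero`): this keeps
`localTateRep W p (galRestrictPlace v) = tateLocalRep W p (Sum.inr v)` definitional
(`localTateRep_galRestrictPlace`). [folklore] -/
abbrev galRestrictPlace : absoluteGaloisGroup (Place.Completion (Sum.inr v : Place ℚ)) →ₜ* absoluteGaloisGroup ℚ :=
  absGaloisRestrict ℚ (Place.Completion (Sum.inr v : Place ℚ))

omit hv in
/-- `localTateRep W p (galRestrictPlace v)` IS the tree's `tateLocalRep W p (Sum.inr v)`. [folklore] -/
theorem localTateRep_galRestrictPlace :
    localTateRep W p (galRestrictPlace v) =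
      Summit.BirchSwinnertonDyer.Rank1Residual.GaloisImage.tateLocalRep W p (Sum.inr v) := rfl

/-- The valuative structure of `ℚ_v = Place.Completion (inr v)` (definitionally `v.adicCompletion ℚ`;
the tree's accepted instance, re-keyed on the `Place.Completion` spelling used by `tateLocalRep`). [folklore] -/
abbrev valuativeRelPlace : ValuativeRel (Place.Completion (Sum.inr v : Place ℚ)) :=
  (inferInstance : ValuativeRel (v.adicCompletion ℚ))

/-- The topology of `ℚ_v = Place.Completion (inr v)` (definitionally `v.adicCompletion ℚ`). [folklore] -/
abbrev topologicalSpacePlace : TopologicalSpace (Place.Completion (Sum.inr v : Place ℚ)) :=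
  (inferInstance : TopologicalSpace (v.adicCompletion ℚ))

attribute [local instance] valuativeRelPlace topologicalSpacePlace

omit [Fact p.Prime] hv in
/-- `ℚ_v` is a non-archimedean local field (the tree's `instIsNonarchimedeanLocalFieldAdicCompletion`). [folklore] -/
theorem isNonarchimedeanLocalField_place :
    IsNonarchimedeanLocalField (Place.Completion (Sum.inr v : Place ℚ)) :=
  (inferInstance : IsNonarchimedeanLocalField (v.adicCompletion ℚ))

omit [Fact p.Prime] hv in
/-- `ℚ_v` has characteristic `0` (`LocalField.charZero_adicCompletion`). [folklore] -/
theorem charZero_place : CharZero (Place.Completion (Sum.inr v : Place ℚ)) :=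
  LocalField.charZero_adicCompletion v

attribute [local instance] isNonarchimedeanLocalField_place charZero_place

omit [Fact p.Prime] in
/-- **`|p|_v < 1` in `ℚ_v` for `v ∣ p`** (`LocalField.valuation_adicCompletion_natCast_lt_one`): the
hypothesis `hp` of the tree's `bdRPeriodRingData`. [folklore] -/
theorem valuation_place_lt_one :
    valuation (Place.Completion (Sum.inr v : Place ℚ)) (p : Place.Completion (Sum.inr v : Place ℚ)) < 1 :=
  LocalField.valuation_adicCompletion_natCast_lt_one v p hv.out

/-- The CANONICAL `ℚ_p`-algebra structure of `ℚ_v`, `v ∣ p` (`LocalField.adicCompletionPadicAlgebra`,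
the unique continuous `ℚ_p → ℚ_v`). [folklore] -/
abbrev padicAlgebraPlace : Algebra ℚ_[p] (Place.Completion (Sum.inr v : Place ℚ)) :=
  LocalField.adicCompletionPadicAlgebra v p hv.out

omit [Fact p.Prime] in
/-- `p` is not a unit of `𝒪_{ℂ_{ℚ_v}}` (`not_isUnit_natCast_integerC`). [folklore] -/
theorem fact_not_isUnit_place : Fact (¬ IsUnit (p : integerC (Place.Completion (Sum.inr v : Place ℚ)))) :=
  ⟨not_isUnit_natCast_integerC (valuation_place_lt_one p v)⟩

/-- `𝒪_{ℂ_{ℚ_v}}` is `p`-adically complete (`isAdicComplete_integerC_natCast`). [folklore] -/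
theorem isAdicComplete_place :
    IsAdicComplete (Ideal.span {(p : integerC (Place.Completion (Sum.inr v : Place ℚ)))})
      (integerC (Place.Completion (Sum.inr v : Place ℚ))) :=
  isAdicComplete_integerC_natCast (valuation_place_lt_one p v)

attribute [local instance] padicAlgebraPlace fact_not_isUnit_place isAdicComplete_place

/-- **A local Néron line of `W/ℚ` at the place `v ∣ p`**: a generator of `D⁰_dR(V_pW|_{Γ_{ℚ_v}})` for
Fontaine's `B_dR(ℚ_v)` (the tree's `bdRPeriodRingData` with the canonical `ℚ_p`-algebra structure of
`ℚ_v`; instances `valuativeRelPlace` … `isAdicComplete_place` of this file, keyed on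
`[Fact ((p : 𝓞 ℚ) ∈ v.asIdeal)]`). [cite: Kato1993LNM1553, Ch. II Ex. 1.3.5 and §2.1.3] -/
abbrev LocalNeronLineAt : Type :=
  LocalNeronLine W (valuation_place_lt_one p v) (galRestrictPlace v)

variable {W p v}

/-- **`exp*_ω : H¹(ℚ_v, T_pW) → ℚ_v`** at the place `v ∣ p`, on the tree's local currency
`(tateLocalRep W p (Sum.inr v)).cohomology 1` (= `H¹` of `localTateRep W p (absGaloisRestrict ℚ ℚ_v)`
definitionally, `localTateRep_absGaloisRestrict`). [cite: Kato1993LNM1553, Ch. II §1.2.4 and Ex. 1.3.5] -/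
def expStarOmegaAt (d : LocalNeronLineAt W p v)
    (y : (Summit.BirchSwinnertonDyer.Rank1Residual.GaloisImage.tateLocalRep W p (Sum.inr v)).cohomology 1) :
    Place.Completion (Sum.inr v : Place ℚ) :=
  expStarOmega (valuation_place_lt_one p v) (galRestrictPlace v) d y

/-- `exp*_ω [η]` at the place `v` is the coordinate of Kato's `exp*` of the push-forward of `η` to `V_pW`.
[cite: Kato1993LNM1553, Ch. II §1.2.4] -/
theorem expStarOmegaAt_oneCocycleClass (d : LocalNeronLineAt W p v)
    (η : contOneCocycles
      (Summit.BirchSwinnertonDyer.Rank1Residual.GaloisImage.tateLocalRep W p (Sum.inr v)).toTopRep) :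
    expStarOmegaAt d (oneCocycleClass _ η) =
      (bdRPeriodRingData (valuation_place_lt_one p v)).dualExpCoord (logCyclotomic p)
        (localRationalTateRep W p (galRestrictPlace v)) d.ω
        fun σ => (pushRational p η).1 σ :=
  expStarOmega_oneCocycleClass _ _ d η

section PropOneTwoThree

/-! The two halves of Kato's Prop. 1.2.3 for `V_pW` over `ℚ_v` — injectivity of `x ↦ x ∪ log χ_cyclo` on
`D⁰_dR`, and a dual exponential for every continuous crossed homomorphism — as section hypotheses
(the tree's predicates `CupLogInjective` / `HasDualExp`; to be discharged by the Prop-1.2.3 cite item). -/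
variable (d : LocalNeronLineAt W p v)
  (hinj : (bdRPeriodRingData (valuation_place_lt_one p v)).CupLogInjective (logCyclotomic p)
    (localRationalTateRep W p (galRestrictPlace v)))
  (hex : ∀ z : contOneCocycles (localRationalTateRep W p (galRestrictPlace v)).toTopRep,
    (bdRPeriodRingData (valuation_place_lt_one p v)).HasDualExp (logCyclotomic p)
      (localRationalTateRep W p (galRestrictPlace v)) fun σ => z.1 σ)

include hinj hex in
/-- **Additivity of `exp*_ω` at the place `v`** under the two Prop-1.2.3 binders for `V_pW` over `ℚ_v`.
[cite: Kato1993LNM1553, Ch. II Prop. 1.2.3 and §1.2.4] -/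
theorem expStarOmegaAt_add
    (y y' : (Summit.BirchSwinnertonDyer.Rank1Residual.GaloisImage.tateLocalRep W p (Sum.inr v)).cohomology 1) :
    expStarOmegaAt d (y + y') = expStarOmegaAt d y + expStarOmegaAt d y' :=
  expStarOmega_add _ _ d hinj hex y y'

/-- **`exp*_ω : H¹(ℚ_v, T_pW) →+ ℚ_v`** (additive map, under the Prop-1.2.3 binders).
[cite: Kato1993LNM1553, Ch. II §1.2.4 and Prop. 1.2.3] -/
def expStarOmegaAtHom :
    (Summit.BirchSwinnertonDyer.Rank1Residual.GaloisImage.tateLocalRep W p (Sum.inr v)).cohomology 1 →+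
      Place.Completion (Sum.inr v : Place ℚ) :=
  AddMonoidHom.mk' (expStarOmegaAt d) (expStarOmegaAt_add d hinj hex)

/-- Unfolding `expStarOmegaAtHom`. [cite: Kato1993LNM1553, Ch. II §1.2.4] -/
@[simp] theorem expStarOmegaAtHom_apply
    (y : (Summit.BirchSwinnertonDyer.Rank1Residual.GaloisImage.tateLocalRep W p (Sum.inr v)).cohomology 1) :
    expStarOmegaAtHom d hinj hex y = expStarOmegaAt d y := rfl

/-- **`exp*_ω : H¹(ℚ_v, T_pW) →+ ℚ_p`** — the scalar dual exponential read in `ℚ_p` through a ring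
homomorphism `ι : ℚ_v → ℚ_p` (for `K = ℚ` the unique one, an isomorphism; e.g. Mathlib's
`adicCompletion.padicEquiv v`). This is EXACTLY the type
`(tateLocalRep W p (Sum.inr v)).cohomology 1 →+ ℚ_[p]` of the abstract functional `φ = exp*_ω` in the
W2 residual packages (kim3's hK on crux 19560, w2-c3's (C1ₑₓ) behind cruxes 19075/19076): with
`φ := expStarOmegaPadicAt d hinj hex ι` their displayed `hker` / `hdual` become statements about a DEFINED
object ([BK90] Prop. 3.8 / Ex. 3.11 and Tate duality — the (S5) cite items). [cite: Kato1993LNM1553, Ch. II §1.2.4 and Ex. 1.3.5] -/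
def expStarOmegaPadicAt (ι : Place.Completion (Sum.inr v : Place ℚ) →+* ℚ_[p]) :
    (Summit.BirchSwinnertonDyer.Rank1Residual.GaloisImage.tateLocalRep W p (Sum.inr v)).cohomology 1 →+ ℚ_[p] :=
  ι.toAddMonoidHom.comp (expStarOmegaAtHom d hinj hex)

/-- Unfolding `expStarOmegaPadicAt`. [cite: Kato1993LNM1553, Ch. II §1.2.4] -/
@[simp] theorem expStarOmegaPadicAt_apply (ι : Place.Completion (Sum.inr v : Place ℚ) →+* ℚ_[p])
    (y : (Summit.BirchSwinnertonDyer.Rank1Residual.GaloisImage.tateLocalRep W p (Sum.inr v)).cohomology 1) :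
    expStarOmegaPadicAt d hinj hex ι y = ι (expStarOmegaAt d y) := rfl

/-- **The kernel of `exp*_ω` at `v` in `ℚ_p`-currency is the kernel in `ℚ_v`-currency** (`ι` is a ring
homomorphism of fields, hence injective): the consumers' `hker` clause is insensitive to `ι` and to the
generator (prequel's `expStarOmega_smul_eq_zero_iff`). [cite: Kato1993LNM1553, Ch. II §1.2.4] -/
theorem expStarOmegaPadicAt_eq_zero_iff (ι : Place.Completion (Sum.inr v : Place ℚ) →+* ℚ_[p])
    (y : (Summit.BirchSwinnertonDyer.Rank1Residual.GaloisImage.tateLocalRep W p (Sum.inr v)).cohomology 1) :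
    expStarOmegaPadicAt d hinj hex ι y = 0 ↔ expStarOmegaAt d y = 0 := by
  rw [expStarOmegaPadicAt_apply, map_eq_zero_iff ι ι.injective]

/-- **Scale law at the place**: `exp*_{e•ω} = e⁻¹ · exp*_ω` (`e ≠ 0`), so the kernel does not depend on
the generator of the Néron line. [cite: Kato1993LNM1553, Ch. II §1.2.4 and Ex. 1.3.5] -/
theorem expStarOmegaAt_smul_eq_zero_iff {e : Place.Completion (Sum.inr v : Place ℚ)} (he : e ≠ 0)
    (y : (Summit.BirchSwinnertonDyer.Rank1Residual.GaloisImage.tateLocalRep W p (Sum.inr v)).cohomology 1) :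
    expStarOmegaAt (d.smul e he) y = 0 ↔ expStarOmegaAt d y = 0 :=
  expStarOmega_smul_eq_zero_iff _ _ d he y

end PropOneTwoThree

end Summit.BirchSwinnertonDyer.BirchSwinnertonDyer.Theorems.KimAtThreeDeepLowerExpStarOmegaPlace

end
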